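import Literature.Analysis.FluidPDE.SelfSimilarEulerProfile
import Literature.Analysis.FluidPDE.AncientSimilarityVorticity
import Literature.Analysis.FluidPDE.TaoQuantitativeLPVorticity
import HarnessLib

/-!
# Self-similar Euler profiles: the vorticity form (3.4) from the velocity form (3.3),
# the Bernoulli Lyapunov function and the escape of far trajectories — proofs companion

Analysis/FluidPDE proofs file (theorems only: no definitions, no named facts), companion of
`SelfSimilarEulerProfile.lean` (request `defn-IsSelfSimilarEulerProfile`, route
`NavierStokesRegularity/VortexLineClock`). Constantin–Ignatova–Vicol (arXiv:2602.17570, §3.1.1)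
state the stationary self-similar Euler equation in velocity form (3.3),
`(1−γ)U + γ(y·∇)U + (U·∇)U + ∇P = 0`, `∇·U = 0`, "or equivalently" in vorticity form (3.4),
`Ω + γ(y·∇)Ω + (U·∇)Ω = (Ω·∇)U`, `Ω = ∇ × U`, `∇·U = 0`. This file PROVES the forward
implication for the tree's predicates (centre `c`):

* `IsSelfSimilarEulerProfile.contDiff_two_pressure` — the pressure of a `C²` profile is `C²`
  (`∇P = −((1−γ)U + (V·∇)U)` is `C¹`), so `curl ∇P = 0` is available;
* `IsSelfSimilarEulerProfile.isSelfSimilarEulerVorticityProfile` — **(3.3) ⇒ (3.4)**: the curl of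
  the profile equation, assembled from the tree's curl calculus: `curl ((y·∇)U) = Ω + (y·∇)Ω`
  (`curl_fderiv_apply_self`), `curl ((e·∇)U) = (e·∇)Ω` (`fderiv_curl_apply_eq_curl_fderiv`),
  `curl ((U·∇)U) = (U·∇)Ω − (Ω·∇)U` for `div U = 0` (`curl_convect_self_of_isDivFree`),
  `curl ∇P = 0` (`curl_gradient_eq_zero_holds`);
* `IsSelfSimilarEulerProfile.inner_fderiv_curl_eq_norm_sq` — CIV Proposition 3.3 (unit
  stretching at the vorticity maximum) for velocity-form profiles.
* normalised vorticities `m Ω = curl U`, `m ≠ 0` (the form inlined by the route items): (3.4) for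
  `Ω` (`IsSelfSimilarEulerVorticityProfile.normalised_vorticity_eq`) and, conversely, the route
  clauses give a vorticity-form profile (`isSelfSimilarEulerVorticityProfile_of_smul_eq_curl`);
* `IsSelfSimilarEulerVorticityProfile.fderiv_curl_transport_sub_fderiv_transport_curl` — the
  commutator identity `[V, Ω] = DΩ[V] − DV[Ω] = −(1+γ)Ω` (infinitesimal form of the self-similar
  Cauchy formula (3.22)), with `DV = γI + DU` (`hasFDerivAt_selfSimilarTransport`) and
  `div V = 3γ` (`divergence_selfSimilarTransport`);
* consequences of the Bernoulli identity (3.31) (`SelfSimilarEulerProfile.lean`): for `γ ≤ ½`,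
  `V·∇ℋ ≤ 0` (`fderiv_selfSimilarBernoulli_transport_nonpos`), strictly `< 0` off the nodal set for
  `γ < ½` (`_neg`, `_eq_zero_iff`) — CIV (3.33), `ℋ` is a Lyapunov function of the self-similar
  Lagrangian flow;
* **escape of far trajectories (CIV §3.5, (3.35))** under the far-field bounds (3.8), `γ > 0`:
  `V(y)·(y − c) ≥ ½γ|y − c|²` for `|y − c| ≥ R♭ = max{1, (2C♭/γ)^γ}`
  (`HasSelfSimilarFarFieldWith.half_mul_sq_le_inner_transport`), hence the nodal set lies in the
  ball `B_{R♭}(c)` (`selfSimilarNodalSet_subset_ball`, CIV footnote to Def. 3.7) and is finite once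
  closed and discrete (`selfSimilarNodalSet_finite_of_isClosed_of_isDiscrete`).

NOT here: the converse (3.4) ⇒ (3.3) (pressure reconstruction); CIV Thm. 3.8 is the sibling
`SelfSimilarEulerOutgoing.lean`; Prop. 3.9 / Thm. 3.10, Thm. 2.1, §4 are not formalised.

## References

* P. Constantin, M. Ignatova, V. Vicol, *On putative self-similarity for incompressible 3D Euler*,
  arXiv:2602.17570 (2026), §3.1.1 eqs. (3.3)–(3.4), §3.3 Prop. 3.3, §3.4.1 (3.22), §3.4.3
  (3.31)–(3.33), §3.5 (3.35) and Def. 3.7 (footnote) [ConstantinIgnatovaVicol2026Putative].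
* A. J. Majda, A. L. Bertozzi, *Vorticity and Incompressible Flow* (CUP 2002), §1.1 (vector
  identities), §2.1 eq. (2.5) (taking the curl of the momentum equation) [MajdaBertozziCUP2002].
-/

noncomputable section

open Set InnerProductSpace
open scoped RealInnerProductSpace

namespace Literature.Analysis.FluidPDE

/-! ### The curl of the profile equation: velocity form (3.3) ⇒ vorticity form (3.4) -/

section VelocityToVorticity

namespace IsSelfSimilarEulerProfile

section General

variable {E : Type*} [NormedAddCommGroup E] [InnerProductSpace ℝ E] [FiniteDimensional ℝ E]
variable {γ : ℝ} {c : E} {U : E → E} {P : E → ℝ}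

/-- The pressure gradient of a profile is determined by the velocity:
`∇P = −((1−γ)U + ((γ(y−c) + U)·∇)U)` (CIV (3.3) solved for `∇P`). [cite: ConstantinIgnatovaVicol2026Putative, §3.1.1 eq. (3.3)] -/
theorem gradient_pressure_eq (h : IsSelfSimilarEulerProfile γ c U P) :
    gradient P = fun y => -((1 - γ) • U y + fderiv ℝ U y (γ • (y - c) + U y)) :=
  funext fun y => eq_neg_of_add_eq_zero_right (h.profile_eq y)

/-- The transport term `y ↦ DU(y)[γ(y−c) + U(y)]` of a profile is `C¹` (`U ∈ C²`). [cite: ConstantinIgnatovaVicol2026Putative, §3.1.1 eq. (3.3)] -/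
theorem contDiff_one_transportTerm (h : IsSelfSimilarEulerProfile γ c U P) :
    ContDiff ℝ 1 fun y => fderiv ℝ U y (γ • (y - c) + U y) := by
  have hDU : ContDiff ℝ 1 (fderiv ℝ U) := h.contDiff_velocity.fderiv_right (m := 1) (by norm_num)
  have hV : ContDiff ℝ 1 fun y => γ • (y - c) + U y :=
    ((contDiff_id.sub contDiff_const).const_smul γ).add (h.contDiff_velocity.of_le (by norm_num))
  exact hDU.clm_apply hV

/-- **The pressure of a profile is automatically `C²`**: by (3.3), `∇P = −((1−γ)U + (V·∇)U)` is
`C¹` for `U ∈ C²`. (So the `C¹` requirement on `P` in `IsSelfSimilarEulerProfile` is no loss.)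
[cite: ConstantinIgnatovaVicol2026Putative, §3.1.1 eq. (3.3)] -/
theorem contDiff_two_pressure (h : IsSelfSimilarEulerProfile γ c U P) : ContDiff ℝ 2 P := by
  have hgrad : ContDiff ℝ 1 (gradient P) := by
    rw [h.gradient_pressure_eq]
    exact (((h.contDiff_velocity.of_le (by norm_num)).const_smul (1 - γ)).add
      h.contDiff_one_transportTerm).neg
  have hfd : ContDiff ℝ 1 (fderiv ℝ P) := by
    rw [← toDual_comp_gradient]
    exact (toDual ℝ E).contDiff.comp hgrad
  have h2 : ContDiff ℝ ((1 : WithTop ℕ∞) + 1) P :=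
    contDiff_succ_iff_fderiv.2 ⟨h.differentiable_pressure, fun h1 => absurd h1 (by simp), hfd⟩
  exact h2.of_le (by norm_num)

/-- The pressure gradient of a profile is differentiable. [cite: ConstantinIgnatovaVicol2026Putative, §3.1.1 eq. (3.3)] -/
theorem differentiable_gradient_pressure (h : IsSelfSimilarEulerProfile γ c U P) :
    Differentiable ℝ (gradient P) := by
  rw [h.gradient_pressure_eq]
  exact (((h.differentiable_velocity).const_smul (1 - γ)).add
    (h.contDiff_one_transportTerm.differentiable one_ne_zero)).neg

end General

variable {γ : ℝ} {c : (EuclideanSpace ℝ (Fin 3))}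
variable {U : (EuclideanSpace ℝ (Fin 3)) → (EuclideanSpace ℝ (Fin 3))} {P : (EuclideanSpace ℝ (Fin 3)) → ℝ}

/-- **Velocity form ⇒ vorticity form** (Constantin–Ignatova–Vicol, §3.1.1: "(3.3), or
equivalently, … (3.4)"). For a `C²` profile `(U, P)` of the stationary self-similar Euler equation
in velocity form, `Ω = curl U` satisfies `Ω + ((γ(y−c) + U)·∇)Ω = (Ω·∇)U`: take the curl of (3.3),
using `curl ((1−γ)U) = (1−γ)Ω`, `curl (γ ((y−c)·∇)U) = γΩ + γ ((y−c)·∇)Ω`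
(`curl_fderiv_apply_self`, `fderiv_curl_apply_eq_curl_fderiv`), `curl ((U·∇)U) = (U·∇)Ω − (Ω·∇)U`
for `div U = 0` (`curl_convect_self_of_isDivFree`) and `curl ∇P = 0` (`P ∈ C²` by
`contDiff_two_pressure`). [cite: ConstantinIgnatovaVicol2026Putative, §3.1.1 eqs. (3.3)–(3.4)] -/
theorem isSelfSimilarEulerVorticityProfile (h : IsSelfSimilarEulerProfile γ c U P) :
    IsSelfSimilarEulerVorticityProfile γ c U where
  contDiff_velocity := h.contDiff_velocity
  divFree := h.divFree
  vorticity_eq y := by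
    have hU2 : ContDiff ℝ 2 U := h.contDiff_velocity
    have hP2 : ContDiff ℝ 2 P := h.contDiff_two_pressure
    -- differentiability of the summands of (3.3) at `y`
    have hd : DifferentiableAt ℝ (fderiv ℝ U) y :=
      ((hU2.fderiv_right (m := 1) (by norm_num)).differentiable one_ne_zero).differentiableAt
    have dU : DifferentiableAt ℝ U y := h.differentiable_velocity y
    have dA : DifferentiableAt ℝ (fun z => fderiv ℝ U z z) y := hd.clm_apply differentiableAt_id
    have dB : DifferentiableAt ℝ (fun z => fderiv ℝ U z c) y :=
      hd.clm_apply (differentiableAt_const c)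
    have dC : DifferentiableAt ℝ (fun z => fderiv ℝ U z (U z)) y := hd.clm_apply dU
    have dP : DifferentiableAt ℝ (gradient P) y := h.differentiable_gradient_pressure y
    -- the curls of the summands
    have c1 : curl (fun z => (1 - γ) • U z) y = (1 - γ) • curl U y := curl_const_smul dU _
    have c2 : curl (fun z => γ • fderiv ℝ U z z) y = γ • (curl U y + fderiv ℝ (curl U) y y) := by
      rw [curl_const_smul dA, curl_fderiv_apply_self hU2]
    have c3 : curl (fun z => γ • fderiv ℝ U z c) y = γ • fderiv ℝ (curl U) y c := by
      rw [curl_const_smul dB, ← fderiv_curl_apply_eq_curl_fderiv hU2]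
    have c4 : curl (fun z => fderiv ℝ U z (U z)) y =
        fderiv ℝ (curl U) y (U y) - fderiv ℝ U y (curl U y) :=
      curl_convect_self_of_isDivFree hU2 h.divFree y
    have c5 : curl (gradient P) y = 0 := curl_gradient_eq_zero_holds P hP2 y
    -- (3.3) as an identity of functions, regrouped, and its curl
    have hF : (fun z => (1 - γ) • U z +
        (γ • fderiv ℝ U z z - γ • fderiv ℝ U z c + fderiv ℝ U z (U z)) + gradient P z) =
        fun _ => (0 : (EuclideanSpace ℝ (Fin 3))) := by
      funext z
      have e := h.profile_eq z
      rw [map_add, map_smul, map_sub, smul_sub] at e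
      exact e
    have dM : DifferentiableAt ℝ
        (fun z => γ • fderiv ℝ U z z - γ • fderiv ℝ U z c + fderiv ℝ U z (U z)) y :=
      ((dA.fun_const_smul γ).fun_sub (dB.fun_const_smul γ)).fun_add dC
    have hcurl := congrArg (fun f => curl f y) hF
    simp only [curl_fun_zero] at hcurl
    rw [curl_add ((dU.fun_const_smul _).fun_add dM) dP, curl_add (dU.fun_const_smul _) dM,
      curl_add ((dA.fun_const_smul γ).fun_sub (dB.fun_const_smul γ)) dC,
      curl_sub (dA.fun_const_smul γ) (dB.fun_const_smul γ), c1, c2, c3, c4, c5] at hcurl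
    -- conclude
    rw [← sub_eq_zero, ← hcurl, map_add, map_smul, map_sub]
    module

end IsSelfSimilarEulerProfile

/-- **CIV Proposition 3.3 for velocity-form profiles**: at a global maximum `y_*` of `|Ω|`,
`Ω = curl U`, `⟪Ω(y_*), DU(y_*) Ω(y_*)⟫ = |Ω(y_*)|²` (unit stretching factor). [cite: ConstantinIgnatovaVicol2026Putative, §3.3 Prop. 3.3] -/
theorem IsSelfSimilarEulerProfile.inner_fderiv_curl_eq_norm_sq {γ : ℝ}
    {c : (EuclideanSpace ℝ (Fin 3))} {U : (EuclideanSpace ℝ (Fin 3)) → (EuclideanSpace ℝ (Fin 3))}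
    {P : (EuclideanSpace ℝ (Fin 3)) → ℝ}
    (h : IsSelfSimilarEulerProfile γ c U P) {x : (EuclideanSpace ℝ (Fin 3))}
    (hmax : IsMaxOn (fun y => ‖curl U y‖) univ x) :
    ⟪curl U x, fderiv ℝ U x (curl U x)⟫ = ‖curl U x‖ ^ 2 :=
  h.isSelfSimilarEulerVorticityProfile.inner_fderiv_curl_eq_norm_sq hmax

end VelocityToVorticity

/-! ### Normalised vorticity `m Ω = curl U` (the form inlined by the route items) -/

section Normalised

variable {γ : ℝ} {c : (EuclideanSpace ℝ (Fin 3))}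
variable {U Ω : (EuclideanSpace ℝ (Fin 3)) → (EuclideanSpace ℝ (Fin 3))} {m : ℝ}

/-- A normalised vorticity `Ω = m⁻¹ curl U` (`m ≠ 0`) of a `C²` field is differentiable. [folklore] -/
theorem differentiable_of_smul_eq_curl (hU : ContDiff ℝ 2 U) (hm : m ≠ 0)
    (hΩ : ∀ y, m • Ω y = curl U y) : Differentiable ℝ Ω := by
  have hfun : Ω = fun y => m⁻¹ • curl U y := by
    funext y
    rw [← hΩ y, smul_smul, inv_mul_cancel₀ hm, one_smul]
  rw [hfun]
  exact (differentiable_curl_of_contDiff hU).const_smul m⁻¹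

/-- **The vorticity equation (3.4) is linear in `Ω`**: for a vorticity-form profile and any
normalised vorticity `m Ω = curl U`, `m ≠ 0` (the normalisation `‖Ω(0)‖ = 1` of the route items,
or CIV's (3.6)–(3.7)), `Ω + ((γ(y−c) + U)·∇)Ω = (Ω·∇)U`. [cite: ConstantinIgnatovaVicol2026Putative, §3.1.1 eq. (3.4) with §3.1.2 (3.6)] -/
theorem IsSelfSimilarEulerVorticityProfile.normalised_vorticity_eq
    (h : IsSelfSimilarEulerVorticityProfile γ c U) (hm : m ≠ 0) (hΩ : ∀ y, m • Ω y = curl U y)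
    (y : (EuclideanSpace ℝ (Fin 3))) :
    Ω y + fderiv ℝ Ω y (γ • (y - c) + U y) = fderiv ℝ U y (Ω y) := by
  have hd : Differentiable ℝ Ω := differentiable_of_smul_eq_curl h.contDiff_velocity hm hΩ
  have hfun : curl U = fun y => m • Ω y := funext fun y => (hΩ y).symm
  have e := h.vorticity_eq y
  rw [hfun, fderiv_fun_const_smul (hd y), _root_.smul_apply, map_smul, ← smul_add] at e
  exact smul_right_injective (EuclideanSpace ℝ (Fin 3)) hm e

/-- **Conversely**, the clauses inlined by the route items — `U ∈ C²`, `div U = 0`, a normalised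
vorticity `m Ω = curl U` with `m ≠ 0` solving `((γ(y−c) + U)·∇)Ω − (Ω·∇)U = −Ω` — give a
vorticity-form profile (3.4). [cite: ConstantinIgnatovaVicol2026Putative, §3.1.1 eq. (3.4) with §3.1.2 (3.6)] -/
theorem isSelfSimilarEulerVorticityProfile_of_smul_eq_curl (hU : ContDiff ℝ 2 U)
    (hdiv : VectorCalculus.IsDivFree U) (hm : m ≠ 0) (hΩ : ∀ y, m • Ω y = curl U y)
    (heq : ∀ y, fderiv ℝ Ω y (γ • (y - c) + U y) - fderiv ℝ U y (Ω y) = -(Ω y)) :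
    IsSelfSimilarEulerVorticityProfile γ c U where
  contDiff_velocity := hU
  divFree := hdiv
  vorticity_eq y := by
    have hd : Differentiable ℝ Ω := differentiable_of_smul_eq_curl hU hm hΩ
    have hfun : curl U = fun y => m • Ω y := funext fun y => (hΩ y).symm
    rw [hfun, fderiv_fun_const_smul (hd y), _root_.smul_apply, map_smul, ← smul_add]
    congr 1
    have e := heq y
    rw [sub_eq_iff_eq_add] at e
    rw [e]
    abel

end Normalised

/-! ### The commutator of the transport field and the vorticity (infinitesimal Cauchy formula) -/

section Commutator

variable {γ : ℝ} {c : (EuclideanSpace ℝ (Fin 3))}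
variable {U : (EuclideanSpace ℝ (Fin 3)) → (EuclideanSpace ℝ (Fin 3))}

/-- The transport field of a `C¹` profile is differentiable, with `DV(y) = γ I + DU(y)`
(CIV, §3.4.1: "the vector field `γ y + U(y)` is not divergence free; `∇·(γy + U) = 3γ`").
[cite: ConstantinIgnatovaVicol2026Putative, §3.4 eq. (3.19)] -/
theorem hasFDerivAt_selfSimilarTransport (hU : Differentiable ℝ U)
    (y : (EuclideanSpace ℝ (Fin 3))) :
    HasFDerivAt (selfSimilarTransport γ c U)
      (γ • ContinuousLinearMap.id ℝ (EuclideanSpace ℝ (Fin 3)) + fderiv ℝ U y) y :=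
  (((hasFDerivAt_id y).sub_const c).fun_const_smul γ).fun_add (hU y).hasFDerivAt

/-- `div V = 3γ` on `ℝ³` for a differentiable div-free profile: `tr (γ I + DU) = 3γ + div U`
(CIV, §3.4.1: "`∇·(γy + U(y)) = 3γ`", whence `det ∇_a Y = e^{3γτ}` in the Cauchy formula (3.22)).
[cite: ConstantinIgnatovaVicol2026Putative, §3.4.1 eq. (3.22) (remark after)] -/
theorem divergence_selfSimilarTransport (hU : Differentiable ℝ U)
    (hdiv : VectorCalculus.IsDivFree U) (y : (EuclideanSpace ℝ (Fin 3))) :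
    VectorCalculus.divergence (selfSimilarTransport γ c U) y = 3 * γ := by
  rw [VectorCalculus.divergence, (hasFDerivAt_selfSimilarTransport hU y).fderiv]
  have h0 :
      LinearMap.trace ℝ _ (fderiv ℝ U y : (EuclideanSpace ℝ (Fin 3)) →ₗ[ℝ] (EuclideanSpace ℝ (Fin 3))) = 0 :=
    hdiv y
  have hc :
      ((γ • ContinuousLinearMap.id ℝ (EuclideanSpace ℝ (Fin 3)) + fderiv ℝ U y :
          (EuclideanSpace ℝ (Fin 3)) →L[ℝ] (EuclideanSpace ℝ (Fin 3))) :
        (EuclideanSpace ℝ (Fin 3)) →ₗ[ℝ] (EuclideanSpace ℝ (Fin 3))) =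
      γ • LinearMap.id + (fderiv ℝ U y : (EuclideanSpace ℝ (Fin 3)) →ₗ[ℝ] (EuclideanSpace ℝ (Fin 3))) :=
    rfl
  rw [hc, map_add, map_smul, h0, LinearMap.trace_id, finrank_euclideanSpace, Fintype.card_fin]
  norm_num
  ring

/-- **The commutator identity `[V, Ω] = −(1+γ) Ω`** — the infinitesimal form of CIV's
self-similar Cauchy formula (3.22) `Ω(Y(a,τ)) = e^{−(γ+1)τ} ∇_aY(a,τ) Ω(a)`: for a vorticity-form
profile, `DΩ(y)[V(y)] − DV(y)[Ω(y)] = −(1+γ) Ω(y)` pointwise, `V = γ(y−c) + U`, `Ω = curl U`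
(from (3.4), `DΩ[V] = DU[Ω] − Ω`, and `DV = γ I + DU`). Equivalently the vorticity is a
**conformally invariant field** of the self-similar Lagrangian flow:
`Y(·,τ)_* Ω = e^{(1+γ)τ} Ω ∘ Y`.
[cite: ConstantinIgnatovaVicol2026Putative, §3.4.1 eq. (3.22)] -/
theorem IsSelfSimilarEulerVorticityProfile.fderiv_curl_transport_sub_fderiv_transport_curl
    (h : IsSelfSimilarEulerVorticityProfile γ c U) (y : (EuclideanSpace ℝ (Fin 3))) :
    fderiv ℝ (curl U) y (selfSimilarTransport γ c U y) -
        fderiv ℝ (selfSimilarTransport γ c U) y (curl U y) = -((1 + γ) • curl U y) := by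
  have hU : Differentiable ℝ U := h.contDiff_velocity.differentiable (by norm_num)
  rw [(hasFDerivAt_selfSimilarTransport hU y).fderiv, _root_.add_apply, _root_.smul_apply,
    ContinuousLinearMap.id_apply]
  have e := h.vorticity_eq_transport y
  rw [← sub_eq_zero]
  calc fderiv ℝ (curl U) y (selfSimilarTransport γ c U y) - (γ • curl U y + fderiv ℝ U y (curl U y))
        - -((1 + γ) • curl U y)
      = (curl U y + fderiv ℝ (curl U) y (selfSimilarTransport γ c U y))
          - fderiv ℝ U y (curl U y) := by
        module
    _ = 0 := by rw [e, sub_self]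

end Commutator

/-! ### Consequences: the Bernoulli function as a Lyapunov function, escape of far trajectories -/

section Consequences

namespace IsSelfSimilarEulerProfile

variable {E : Type*} [NormedAddCommGroup E] [InnerProductSpace ℝ E] [FiniteDimensional ℝ E]
variable {γ : ℝ} {c : E} {U : E → E} {P : E → ℝ}

/-- **CIV (3.33): for `γ ≤ ½` the Bernoulli function is non-increasing along the transport field**,
`V·∇ℋ = (2γ−1)|V|² ≤ 0`. [cite: ConstantinIgnatovaVicol2026Putative, §3.4.3 eq. (3.33)] -/
theorem fderiv_selfSimilarBernoulli_transport_nonpos (h : IsSelfSimilarEulerProfile γ c U P)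
    (hγ : γ ≤ 1 / 2) (y : E) :
    fderiv ℝ (selfSimilarBernoulli γ c U P) y (selfSimilarTransport γ c U y) ≤ 0 := by
  rw [h.fderiv_selfSimilarBernoulli_transport y]
  exact mul_nonpos_of_nonpos_of_nonneg (by linarith) (sq_nonneg _)

/-- **CIV (3.33), strictness**: for `γ < ½`, `V·∇ℋ < 0` off the nodal set `𝒩_V` ("with equality if
and only if `V = 0`"). [cite: ConstantinIgnatovaVicol2026Putative, §3.4.3 eq. (3.33)] -/
theorem fderiv_selfSimilarBernoulli_transport_neg (h : IsSelfSimilarEulerProfile γ c U P)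
    (hγ : γ < 1 / 2) {y : E} (hy : y ∉ selfSimilarNodalSet γ c U) :
    fderiv ℝ (selfSimilarBernoulli γ c U P) y (selfSimilarTransport γ c U y) < 0 := by
  rw [h.fderiv_selfSimilarBernoulli_transport y]
  have hV : selfSimilarTransport γ c U y ≠ 0 := hy
  have hpos : 0 < ‖selfSimilarTransport γ c U y‖ ^ 2 := by positivity
  exact mul_neg_of_neg_of_pos (by linarith) hpos

/-- For `γ < ½`, `V·∇ℋ = 0` exactly on the nodal set (CIV (3.33): "with equality if and only if
`V(Y(a,τ)) = 0`"). [cite: ConstantinIgnatovaVicol2026Putative, §3.4.3 eq. (3.33)] -/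
theorem fderiv_selfSimilarBernoulli_transport_eq_zero_iff (h : IsSelfSimilarEulerProfile γ c U P)
    (hγ : γ < 1 / 2) (y : E) :
    fderiv ℝ (selfSimilarBernoulli γ c U P) y (selfSimilarTransport γ c U y) = 0 ↔
      y ∈ selfSimilarNodalSet γ c U := by
  rw [h.fderiv_selfSimilarBernoulli_transport y, mul_eq_zero]
  constructor
  · rintro (h1 | h2)
    · exact absurd h1 (by linarith)
    · exact norm_eq_zero.1 ((pow_eq_zero_iff two_ne_zero).1 h2)
  · intro hy
    right
    rw [show selfSimilarTransport γ c U y = 0 from hy, norm_zero, zero_pow two_ne_zero]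

end IsSelfSimilarEulerProfile

namespace HasSelfSimilarFarFieldWith

variable {γ C : ℝ} {c : (EuclideanSpace ℝ (Fin 3))}
variable {U : (EuclideanSpace ℝ (Fin 3)) → (EuclideanSpace ℝ (Fin 3))}

/-- **Trajectories with large labels are outgoing (CIV §3.5, (3.35)).** Under the far-field bounds
(3.8) with constant `C♭ = C` and `γ > 0`: for `|y − c| ≥ R♭ := max{1, (2C♭/γ)^γ}` one has
`|U(y)·(y − c)| ≤ ½γ|y − c|²`, hence `V(y)·(y − c) = (γ(y−c) + U(y))·(y − c) ≥ ½γ|y − c|²`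
(`|U(y)| ≤ C|y−c|⟨y−c⟩^{−1/γ} ≤ C|y−c| |y−c|^{−1/γ}` and `|y−c|^{1/γ} ≥ 2C/γ`).
[cite: ConstantinIgnatovaVicol2026Putative, §3.5 eq. (3.35)] -/
theorem half_mul_sq_le_inner_transport (h : HasSelfSimilarFarFieldWith γ c C U) (hγ : 0 < γ)
    {y : (EuclideanSpace ℝ (Fin 3))} (hy : max 1 ((2 * C / γ) ^ γ) ≤ ‖y - c‖) :
    γ / 2 * ‖y - c‖ ^ 2 ≤ ⟪selfSimilarTransport γ c U y, y - c⟫ := by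
  have hC : 0 ≤ C := h.nonneg
  set r : ℝ := ‖y - c‖ with hr
  have hr1 : 1 ≤ r := le_trans (le_max_left _ _) hy
  have hr0 : 0 < r := by linarith
  have hrR : (2 * C / γ) ^ γ ≤ r := le_trans (le_max_right _ _) hy
  -- `⟨y − c⟩^{−1/γ} ≤ r^{−1/γ}`
  have hbr : (1 + r ^ 2) ^ (-(1 / (2 * γ))) ≤ r ^ (-(1 / γ)) := by
    have e1 : r ^ (-(1 / γ)) = (r ^ (2 : ℝ)) ^ (-(1 / (2 * γ))) := by
      rw [← Real.rpow_mul hr0.le]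
      congr 1
      field_simp
    rw [e1, ← Real.rpow_two, Real.rpow_two]
    exact Real.rpow_le_rpow_of_nonpos (by positivity) (by linarith) (by
      have : 0 < 1 / (2 * γ) := by positivity
      linarith)
  -- `C r^{−1/γ} ≤ γ/2`
  have hsmall : C * r ^ (-(1 / γ)) ≤ γ / 2 := by
    have h1 : 2 * C / γ ≤ r ^ (1 / γ) := by
      have h2 : 0 ≤ 2 * C / γ := by positivity
      calc 2 * C / γ = ((2 * C / γ) ^ γ) ^ (1 / γ) := by
            rw [← Real.rpow_mul h2, mul_one_div_cancel hγ.ne', Real.rpow_one]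
        _ ≤ r ^ (1 / γ) := Real.rpow_le_rpow (by positivity) hrR (by positivity)
    have h3 : 0 < r ^ (1 / γ) := Real.rpow_pos_of_pos hr0 _
    rw [Real.rpow_neg hr0.le, ← div_eq_mul_inv, div_le_iff₀ h3]
    rw [div_le_iff₀ hγ] at h1
    nlinarith
  -- `|U(y)·(y − c)| ≤ ½γ r²`
  have hU : |⟪U y, y - c⟫| ≤ γ / 2 * r ^ 2 := by
    calc |⟪U y, y - c⟫| ≤ ‖U y‖ * ‖y - c‖ := abs_real_inner_le_norm _ _
      _ ≤ C * r * (1 + r ^ 2) ^ (-(1 / (2 * γ))) * r := by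
          rw [← hr]; gcongr; exact hr ▸ h.norm_le y
      _ ≤ C * r * r ^ (-(1 / γ)) * r := by gcongr
      _ = C * r ^ (-(1 / γ)) * r ^ 2 := by ring
      _ ≤ γ / 2 * r ^ 2 := by gcongr
  rw [selfSimilarTransport_apply, inner_add_left, inner_smul_left, conj_trivial,
    real_inner_self_eq_norm_sq, ← hr]
  have := neg_abs_le ⟪U y, y - c⟫
  nlinarith

/-- **The nodal set is bounded** (CIV, footnote to Def. 3.7: "the bound (3.8) implies
`𝒩_V ⊆ B_{R♭}(0)`"): under (3.8) with `γ > 0`, every stagnation point `y_*` of `V` satisfies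
`|y_* − c| < R♭ = max{1, (2C♭/γ)^γ}`. [cite: ConstantinIgnatovaVicol2026Putative, §3.5 eq. (3.35) and Def. 3.7 (footnote)] -/
theorem selfSimilarNodalSet_subset_ball (h : HasSelfSimilarFarFieldWith γ c C U) (hγ : 0 < γ) :
    selfSimilarNodalSet γ c U ⊆ Metric.ball c (max 1 ((2 * C / γ) ^ γ)) := by
  intro y hy
  rw [Metric.mem_ball, dist_eq_norm]
  by_contra hfar
  push Not at hfar
  have h1 := h.half_mul_sq_le_inner_transport hγ hfar
  rw [show selfSimilarTransport γ c U y = 0 from hy, inner_zero_left] at h1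
  have h2 : 1 ≤ ‖y - c‖ := le_trans (le_max_left _ _) hfar
  have h3 : 0 < γ / 2 * ‖y - c‖ ^ 2 := mul_pos (half_pos hγ) (pow_pos (lt_of_lt_of_le one_pos h2) 2)
  linarith

/-- Hence, under (3.8) with `γ > 0`, **the nodal set is finite as soon as it has no accumulation
points**, i.e. as soon as it is discrete and closed — here in the convenient form: a closed nodal
set all of whose points are isolated is finite (CIV, footnote to Def. 3.7). [cite: ConstantinIgnatovaVicol2026Putative, §3.5 Def. 3.7 (footnote)] -/
theorem selfSimilarNodalSet_finite_of_isClosed_of_isDiscrete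
    (h : HasSelfSimilarFarFieldWith γ c C U) (hγ : 0 < γ)
    (hcl : IsClosed (selfSimilarNodalSet γ c U))
    (hdisc : IsDiscrete (selfSimilarNodalSet γ c U)) : (selfSimilarNodalSet γ c U).Finite := by
  have hbdd : Bornology.IsBounded (selfSimilarNodalSet γ c U) :=
    Metric.isBounded_ball.subset (h.selfSimilarNodalSet_subset_ball hγ)
  have hK : IsCompact (selfSimilarNodalSet γ c U) := Metric.isCompact_of_isClosed_isBounded hcl hbdd
  exact hK.finite hdisc

end HasSelfSimilarFarFieldWith

end Consequences

end Literature.Analysis.FluidPDE
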